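import Literature.AnabelianGeometry.SemiGraphs.TemperedSpecialFibre
import HarnessLib

/-!
# Corollary 3.11 as a REDUCTION to the steps of its printed proof

Mochizuki, *Semi-graphs of anabelioids*, Publ. RIMS **42** (2006), §3, Corollary 3.11 and its proof,
manuscript pp. 45–49 [cite: MochizukiSemiAnbd2006, Cor 3.11 pp.45-49].  The predicate `Cor311`
(`TemperedSpecialFibre.lean`; FACT-policy: it rests on the tempered fundamental groups of actual
curves) is derived here from NAMED RESIDUAL FACTS, one per step of the printed proof, typed over the
same origin hypotheses `Ωα`, `Ωβ` and quoting their lines: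

* (S1) `AdmissibleQuotientCompatible` — pp. 46, 48: the admissible quotient
  `Δ[□] ↠ π₁^temp(G[□]) ≅ π₁^temp(G^c[□])` "may be characterized" group-theoretically (via
  `I_Σ = J_Σ`, "free discrete groups inject into their pro-`Σ` completions [cf. Remark 1.7.1]", and
  the characterisation of p. 48 by "purity of the branch locus" and "[Tama2], Lemma 2.1"), hence is
  COMPATIBLE with any `γ : Δ[α] ⥲ Δ[β]`: `γ` descends to an isomorphism of the tempered fundamental
  groups of the special fibres;
* (S3) `SpecialFibreIsoOfChartIso` — pp. 46–48: Corollary 3.9 applied to `G[□]_Σ`, `G[□]` and the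
  observations (i)–(iv) on cusps ("it follows formally from (i), (ii), (iii), (iv) that the natural,
  functorial isomorphism of graphs of anabelioids `G[α]_Σ ⥲ G[β]_Σ` induced by `γ` extends uniquely to
  a natural, functorial isomorphism of semi-graphs of anabelioids `G^c[α]_Σ ⥲ G^c[β]_Σ`"): an
  isomorphism of the tempered fundamental groups of the special fibres comes from an isomorphism of
  the semi-graphs of anabelioids with compact structure, unique on underlying semi-graphs;
* (S2) `ResidueCharOfTemperedIso` — p. 48: "we obtain that `p_α = p_β`" (inertia groups `I_v` of
  order a power of `p_□`).

PROVED glue: `corollary_3_11_of_steps` — including the uniqueness clause of `Cor311`, which needs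
that the descended isomorphism of (S1) is UNIQUE (the admissible quotient is surjective,
`SpecialFibreData.admissible_surjective`), so that the uniqueness of (S3) applies to every compatible
`F'`.  Proof-structure file; no statement of `TemperedSpecialFibre.lean` is altered; nothing here takes
a side on [IUTchIII] Cor. 3.12; typed ≠ discharged (S1–S3 are open named facts, FACT-policy).
-/

open CategoryTheory Topology

noncomputable section

namespace Literature.AnabelianGeometry.SemiGraphs

open ProfiniteSemiGraph

universe u

variable {Kα : Type u} [Field Kα] {Kβ : Type u} [Field Kβ]

/-- Compatibility of an isomorphism `φ : π₁^temp(G^c[α]) ⥲ π₁^temp(G^c[β])` of the tempered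
fundamental groups of the special fibres with an isomorphism `F : G^c[α] ⥲ G^c[β]` of semi-graphs of
anabelioids: `φ` is compatible, up to conjugation, with the verticial homomorphisms at `v` and `F v`
and the vertex isomorphisms of `F` (the inner clause of `Cor311Compatible`, p. 46 "compatible").
[cite: MochizukiSemiAnbd2006, Cor 3.11 p.46] -/
def SpecialFibreData.ChartCompatible {Dα : TemperedArithmeticGroup Kα}
    {Dβ : TemperedArithmeticGroup Kβ} (Sα : SpecialFibreData Dα) (Sβ : SpecialFibreData Dβ)
    (φ : Sα.chart.G ≃ₜ* Sβ.chart.G) (F : Hom Sα.Gc Sβ.Gc) : Prop :=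
  ∀ (v : Sα.Gc.graph.Vertex) (ψα : Sα.Gc.Gv v →ₜ* Sα.chart.G)
    (ψβ : Sβ.Gc.Gv (F.base.vertexMap v) →ₜ* Sβ.chart.G),
    IsVerticialHom Sα.chart v ψα → IsVerticialHom Sβ.chart (F.base.vertexMap v) ψβ →
      ∃ g : Sβ.chart.G, ∀ x, φ (ψα x) = g * ψβ (F.hV v x) * g⁻¹

/-! ### The named residual facts (steps of the printed proof of Cor. 3.11) -/

/-- (S1) **The admissible quotient is group-theoretic, hence compatible with `γ`** ([SemiAnbd]
Cor. 3.11, proof, p. 46 "the quotients `Δ[□] ↠ Δ[□]_Σ ≅ π₁^temp(G[□]_Σ)` are compatible with `γ`"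
(via `I_Σ[□] = J_Σ[□]`, Rmk. 1.7.1), and p. 48 "the natural quotient `Δ[□] ↠ π₁^temp(G[□]) ≅
π₁^temp(G^c[□])` — i.e., the quotient determined by the 'admissible quotient' of `Δ̂[□]`, in the sense
of [Mzk3], §2 — may be characterized as follows: … this follows immediately from well-known 'purity
of the branch locus' results and the well-known 'structure of local fundamental groups of stable
curves' [cf., e.g., [Tama2], Lemma 2.1]"), named residual fact over the origin hypotheses: every
isomorphism `γ : Δ[α] ⥲ Δ[β]` descends along the admissible quotients to an isomorphism of the
tempered fundamental groups of the special fibres. [cite: MochizukiSemiAnbd2006, Cor 3.11 pp.46-48] -/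
def AdmissibleQuotientCompatible (Ωα : SpecialFibreOrigin Kα) (Ωβ : SpecialFibreOrigin Kβ) : Prop :=
  ∀ (Dα : TemperedArithmeticGroup Kα) (Dβ : TemperedArithmeticGroup Kβ)
    (Sα : SpecialFibreData Dα) (Sβ : SpecialFibreData Dβ),
    Ωα.IsSpecialFibreOf Dα Sα → Ωβ.IsSpecialFibreOf Dβ Sβ →
    ∀ γ : Dα.delta ≃ₜ* Dβ.delta,
      ∃ φ : Sα.chart.G ≃ₜ* Sβ.chart.G, ∀ x : Dα.delta, φ (Sα.admissible x) = Sβ.admissible (γ x)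

/-- (S3) **Reconstruction of `G^c` from `π₁^temp(G^c)`, isomorphism version** ([SemiAnbd] Cor. 3.11,
proof, pp. 46–48: "by Corollary 3.9, we conclude that `γ` induces a natural, functorial isomorphism
of graphs of anabelioids `G[α]_Σ ⥲ G[β]_Σ` … it follows formally from (i), (ii), (iii), (iv) that
[it] extends uniquely to a natural, functorial isomorphism of semi-graphs of anabelioids `G^c[α]_Σ ⥲
G^c[β]_Σ` … hence, in particular, an isomorphism of semi-graphs `G^c[α] ⥲ G^c[β]`", and p. 49 "a
uniquely determined isomorphism of semi-graphs of anabelioids `G^c[α] ⥲ G^c[β]`"), named residual fact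
over the origin hypotheses: every isomorphism of the tempered fundamental groups of the special-fibre
semi-graphs of anabelioids [with compact structure] of two curves arises from an isomorphism of those
semi-graphs of anabelioids compatible with it, unique on underlying semi-graphs.
[cite: MochizukiSemiAnbd2006, Cor 3.11 pp.46-49] -/
def SpecialFibreIsoOfChartIso (Ωα : SpecialFibreOrigin Kα) (Ωβ : SpecialFibreOrigin Kβ) : Prop :=
  ∀ (Dα : TemperedArithmeticGroup Kα) (Dβ : TemperedArithmeticGroup Kβ)
    (Sα : SpecialFibreData Dα) (Sβ : SpecialFibreData Dβ),
    Ωα.IsSpecialFibreOf Dα Sα → Ωβ.IsSpecialFibreOf Dβ Sβ →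
    ∀ φ : Sα.chart.G ≃ₜ* Sβ.chart.G,
      ∃ F : Hom Sα.Gc Sβ.Gc, F.IsIso ∧ Sα.ChartCompatible Sβ φ F ∧
        ∀ F' : Hom Sα.Gc Sβ.Gc, F'.IsIso → Sα.ChartCompatible Sβ φ F' →
          F'.base.vertexMap = F.base.vertexMap ∧ F'.base.edgeMap = F.base.edgeMap

/-- (S2) **The residue characteristic is recovered** ([SemiAnbd] Cor. 3.11, proof, p. 48: "the
inertia group `I_v ⊆ D_v` at `v` … is necessarily of order a power of `p_□` … In particular, [since
there exist `Δ'[□]` for which `I_v` is nontrivial …] we obtain that `p_α = p_β`"), named residual fact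
over the origin hypotheses. [cite: MochizukiSemiAnbd2006, Cor 3.11 p.48] -/
def ResidueCharOfTemperedIso (pα pβ : ℕ) [Fact pα.Prime] [Fact pβ.Prime] [Algebra ℚ_[pα] Kα]
    [FiniteDimensional ℚ_[pα] Kα] [Algebra ℚ_[pβ] Kβ] [FiniteDimensional ℚ_[pβ] Kβ]
    (Ωα : SpecialFibreOrigin Kα) (Ωβ : SpecialFibreOrigin Kβ) : Prop :=
  ∀ (Dα : TemperedArithmeticGroup Kα) (Dβ : TemperedArithmeticGroup Kβ)
    (Sα : SpecialFibreData Dα) (Sβ : SpecialFibreData Dβ),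
    Ωα.IsSpecialFibreOf Dα Sα → Ωβ.IsSpecialFibreOf Dβ Sβ →
    Nonempty (Dα.delta ≃ₜ* Dβ.delta) → pα = pβ

/-! ### Corollary 3.11 from the steps of its proof -/

/-- The isomorphism descended along the admissible quotients is unique: the admissible quotient is
surjective (`SpecialFibreData.admissible_surjective`). [cite: MochizukiSemiAnbd2006, Cor 3.11 p.48] -/
theorem SpecialFibreData.descended_unique {Dα : TemperedArithmeticGroup Kα}
    {Dβ : TemperedArithmeticGroup Kβ} (Sα : SpecialFibreData Dα) (Sβ : SpecialFibreData Dβ)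
    (γ : Dα.delta ≃ₜ* Dβ.delta) {φ φ' : Sα.chart.G ≃ₜ* Sβ.chart.G}
    (hφ : ∀ x : Dα.delta, φ (Sα.admissible x) = Sβ.admissible (γ x))
    (hφ' : ∀ x : Dα.delta, φ' (Sα.admissible x) = Sβ.admissible (γ x)) : φ' = φ := by
  apply ContinuousMulEquiv.ext
  intro y
  obtain ⟨x, rfl⟩ := Sα.admissible_surjective y
  rw [hφ x, hφ' x]

/-- **[SemiAnbd] Cor. 3.11 from the steps of its printed proof** (pp. 45–49): `γ` descends along the
admissible quotients (S1) to an isomorphism `φ` of the tempered fundamental groups of the special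
fibres, which comes from an isomorphism `F : G^c[α] ⥲ G^c[β]` compatible with it (S3) — so `F` is
`Cor311Compatible` with `γ`; any other compatible isomorphism `F'` carries a descended isomorphism,
which equals `φ` (`descended_unique`), so `F'` and `F` agree on underlying semi-graphs by (S3); and
`p_α = p_β` by (S2). [cite: MochizukiSemiAnbd2006, Cor 3.11 pp.45-49] -/
theorem corollary_3_11_of_steps (pα pβ : ℕ) [Fact pα.Prime] [Fact pβ.Prime] [Algebra ℚ_[pα] Kα]
    [FiniteDimensional ℚ_[pα] Kα] [Algebra ℚ_[pβ] Kβ] [FiniteDimensional ℚ_[pβ] Kβ]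
    (Ωα : SpecialFibreOrigin Kα) (Ωβ : SpecialFibreOrigin Kβ)
    (hS1 : AdmissibleQuotientCompatible Ωα Ωβ) (hS2 : ResidueCharOfTemperedIso pα pβ Ωα Ωβ)
    (hS3 : SpecialFibreIsoOfChartIso Ωα Ωβ) : Cor311 pα pβ Ωα Ωβ := by
  intro Dα Dβ Sα Sβ hα hβ γ
  obtain ⟨φ, hφ⟩ := hS1 Dα Dβ Sα Sβ hα hβ γ
  obtain ⟨F, hF, hc, huniq⟩ := hS3 Dα Dβ Sα Sβ hα hβ φ
  refine ⟨⟨F, hF, ⟨φ, hφ, hc⟩, fun F' hF' hcomp' => ?_⟩, hS2 Dα Dβ Sα Sβ hα hβ ⟨γ⟩⟩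
  obtain ⟨φ', hφ', hc'⟩ := hcomp'
  obtain rfl : φ' = φ := Sα.descended_unique Sβ γ hφ hφ'
  exact huniq F' hF' hc'

end Literature.AnabelianGeometry.SemiGraphs

end
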